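import Literature.Geometry.Riemannian.ThreeShrinkerSectionalNonneg
import HarnessLib

/-!
# `S ≥ c log(f/ρ)` on a complete three-dimensional shrinker with `Ric ≥ (c/f) g`
# (Munteanu–Wang 2017, Thm. 2, step 2)

**Theorem** (O. Munteanu, J. Wang, *Positively curved shrinking Ricci solitons are compact*,
J. Differential Geom. 106 (2017), proof of Thm. 2, second step, in dimension three). Let
`(N, h, φ)` be a complete connected three-dimensional gradient shrinking Ricci soliton,
`Ric + Hess φ = ½ h`, normalised by `S + |∇φ|² = φ`, and suppose that on the end `{φ ≥ ρ}`
(`ρ ≥ 1`, `ρ ≥ c > 0`) the Ricci curvature is pinched from below by the potential,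
`Ric ≥ (c/φ) h`. Then on `{φ ≥ ρ}`

  `S ≥ c log(φ/ρ)`                                   (`ThreeShrinker.scalarCurvature_ge_log`).

Munteanu–Wang integrate `⟨∇S, ∇φ⟩ = 2 Ric(∇φ, ∇φ) ≥ 2(c/φ)|∇φ|²` along the flow lines of `∇φ`.
The proof given here is a FIRST-ORDER MINIMUM PRINCIPLE and uses no flow lines: for `ε > 0` the
function `V = S − c log φ + ε φ` is continuous on the closed set `A = {φ ≥ ρ}` and tends to `+∞`
as `φ → ∞` (`S ≥ 0`, Zhang 2009, `shrinkerScalarCurvature_nonneg_holds`; the sub-level sets of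
`φ` are compact, Haslhofer–Müller 2011, `ThreeShrinker.isCompact_potential_le`), so it attains
its minimum over `A` at some `p`. If `φ(p) = ρ` then `V(p) ≥ −c log ρ`. Otherwise `p` is an
interior local minimum, `dV_p = 0` (Fermat, `IsLocalMin.isMCriticalPt`); evaluating on
`Y = ∇φ(p)` with Hamilton's identity `dS(Y) = 2 Ric(∇φ, Y)`
(`mvfderiv_scalarCurvature_of_soliton`) gives
`0 = dV_p(∇φ) = 2 Ric(∇φ,∇φ) − (c/φ)|∇φ|² + ε|∇φ|² ≥ (c/φ + ε)|∇φ|²`, whence `∇φ(p) = 0`,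
`S(p) = φ(p)` by the normalisation, and `V(p) ≥ φ − c log φ ≥ ρ − c log ρ ≥ −c log ρ`
(`log(φ/ρ) ≤ φ/ρ − 1`, `c ≤ ρ`). Hence `S(x) − c log φ(x) + ε φ(x) = V(x) ≥ V(p) ≥ −c log ρ` for
every `ε > 0`, and `ε → 0` gives the claim. Everything is proved; no definition and no named
fact is introduced.

## References

* O. Munteanu, J. Wang, *Positively curved shrinking Ricci solitons are compact*, J. Differential
  Geom. 106 (2017) 499–505, Thm. 2 (proof, step 2). [MunteanuWang2017]
* Z.-H. Zhang, *On the completeness of gradient Ricci solitons*, Proc. AMS 137 (2009),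
  Thm. 1.3. [Zhang2009]
* R. Haslhofer, R. Müller, *A compactness theorem for complete Ricci shrinkers*, GAFA 21 (2011),
  Lemma 2.1. [HaslhoferMuller2011]
-/

noncomputable section

set_option maxSynthPendingDepth 3

open Set Filter Module Metric
open scoped Manifold ContDiff Topology NNReal ENNReal

namespace Literature.Geometry.Riemannian

open Lorentzian Lorentzian.PseudoRiemannianMetric

namespace ThreeShrinker

variable {N : Type} [TopologicalSpace N] [T2Space N] [SecondCountableTopology N]
  [ChartedSpace (EuclideanSpace ℝ (Fin 3)) N] [IsManifold (𝓡 3) ∞ N] [ConnectedSpace N]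
  [T3Space N] [MeasurableSpace N] [BorelSpace N]
  (h : PseudoRiemannianMetric (𝓡 3) ∞ (EuclideanSpace ℝ (Fin 3)) (TangentSpace (𝓡 3) : N → Type _))
  [h.HasLeviCivita] (φ : N → ℝ) (hh : h.IsRiemannian)

/-- The elementary growth bound behind the coercivity of `S − c log φ + ε φ`:
`c log t ≤ (ε/2) t − c − c log(ε/(2c))` for `t, c, ε > 0` (`log s ≤ s − 1` at `s = ε t/(2c)`).
[folklore] -/
theorem mul_log_le_linear {c ε : ℝ} (hc : 0 < c) (hε : 0 < ε) {t : ℝ} (ht : 0 < t) :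
    c * Real.log t ≤ ε / 2 * t - c - c * Real.log (ε / (2 * c)) := by
  have ha : 0 < ε / (2 * c) := by positivity
  have h1 := Real.log_le_sub_one_of_pos (mul_pos ha ht)
  rw [Real.log_mul ha.ne' ht.ne'] at h1
  have h2 : c * (ε / (2 * c) * t) = ε / 2 * t := by field_simp
  have h3 := mul_le_mul_of_nonneg_left h1 hc.le
  linarith

/-- The elementary inequality at a critical point of the potential: for `0 < c ≤ ρ ≤ t`,
`−c log ρ ≤ t − c log t` (`c log(t/ρ) ≤ c (t/ρ − 1) ≤ t − ρ`). [folklore] -/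
theorem neg_mul_log_le_sub_mul_log {c ρ t : ℝ} (hc : 0 < c) (hcρ : c ≤ ρ) (hρt : ρ ≤ t) :
    -(c * Real.log ρ) ≤ t - c * Real.log t := by
  have hρ0 : 0 < ρ := hc.trans_le hcρ
  have ht0 : 0 < t := hρ0.trans_le hρt
  have hlog : Real.log t - Real.log ρ ≤ t / ρ - 1 := by
    rw [← Real.log_div ht0.ne' hρ0.ne']
    exact Real.log_le_sub_one_of_pos (div_pos ht0 hρ0)
  have h1 : c * (t / ρ - 1) ≤ t - ρ := by
    rw [show c * (t / ρ - 1) = c / ρ * (t - ρ) by field_simp]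
    have hcρ1 : c / ρ ≤ 1 := (div_le_one hρ0).2 hcρ
    nlinarith [sub_nonneg.2 hρt]
  nlinarith [mul_le_mul_of_nonneg_left hlog hc.le]

/-- **Munteanu–Wang 2017, Thm. 2, step 2 (dimension three): `S ≥ c log(φ/ρ)` on the end
`{φ ≥ ρ}` of a complete three-dimensional gradient shrinker whose Ricci curvature satisfies
`Ric ≥ (c/φ) h` there** (`0 < c ≤ ρ`, `1 ≤ ρ`; complete connected normalised shrinker
`Ric + Hess φ = ½ h`, `S + |∇φ|² = φ`). Munteanu–Wang integrate `⟨∇S, ∇φ⟩ = 2Ric(∇φ, ∇φ)`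
along the gradient flow of `φ`; here a first-order minimum principle for
`S − c log φ + ε φ` on `{φ ≥ ρ}` replaces the flow lines (module docstring).
[cite: MunteanuWang2017, Thm. 2] -/
theorem scalarCurvature_ge_log
    (hcpl : ∀ (x : N) (r : ℝ≥0), IsCompact {y : N | h.edist hh x y ≤ r})
    (hφ : ContMDiff (𝓡 3) 𝓘(ℝ, ℝ) ∞ φ)
    (hsol : ∀ (x : N) (X Y : TangentSpace (𝓡 3) x),
      h.ricci x X Y + h.hessian φ x X Y = (1 / 2 : ℝ) * h.val x X Y)
    (hnorm : ∀ x : N, h.scalarCurvature x + h.gradSq φ x = φ x)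
    {c ρ : ℝ} (hc : 0 < c) (hcρ : c ≤ ρ) (h1ρ : 1 ≤ ρ)
    (hRic : ∀ (x : N) (w : TangentSpace (𝓡 3) x), ρ ≤ φ x → c / φ x * h.val x w w ≤ h.ricci x w w)
    (x : N) (hx : ρ ≤ φ x) : c * Real.log (φ x / ρ) ≤ h.scalarCurvature x := by
  classical
  have hR0 : ∀ y : N, 0 ≤ h.scalarCurvature y :=
    shrinkerScalarCurvature_nonneg_holds 3 N h φ hh hcpl hφ hsol hnorm
  have hρ0 : 0 < ρ := one_pos.trans_le h1ρ
  have hφpos : ∀ y, ρ ≤ φ y → 0 < φ y := fun y hy ↦ hρ0.trans_le hy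
  have hK : ∀ T : ℝ, IsCompact {y : N | φ y ≤ T} :=
    isCompact_potential_le h φ hh hcpl hφ hsol hnorm hR0
  have hRc : Continuous h.scalarCurvature := (contMDiff_scalarCurvature h).continuous
  have hφc : Continuous φ := hφ.continuous
  -- the value at a critical point of `φ` in `{φ ≥ ρ}`: `S = φ` there
  have hend : ∀ y, ρ ≤ φ y → h.gradSq φ y = 0 →
      -(c * Real.log ρ) ≤ h.scalarCurvature y - c * Real.log (φ y) := by
    intro y hy hG
    have hRy : h.scalarCurvature y = φ y := by
      have h1 := hnorm y
      rwa [hG, add_zero] at h1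
    rw [hRy]
    exact neg_mul_log_le_sub_mul_log hc hcρ hy
  -- it suffices to bound `S − c log φ + ε φ` below by `−c log ρ` for every `ε > 0`
  suffices key : ∀ ε : ℝ, 0 < ε →
      -(c * Real.log ρ) ≤ h.scalarCurvature x - c * Real.log (φ x) + ε * φ x by
    have hx0 := hφpos x hx
    have h1 : -(c * Real.log ρ) ≤ h.scalarCurvature x - c * Real.log (φ x) := by
      refine le_of_forall_pos_le_add fun ε hε ↦ ?_
      have h2 := key (ε / φ x) (div_pos hε hx0)
      rwa [div_mul_cancel₀ ε hx0.ne'] at h2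
    rw [Real.log_div hx0.ne' hρ0.ne', mul_sub]
    linarith
  intro ε hε
  set V : N → ℝ := fun y ↦ h.scalarCurvature y - c * Real.log (φ y) + ε * φ y with hVdef
  -- `V` is continuous on `A = {φ ≥ ρ}`
  have hVc : ContinuousOn V {y | ρ ≤ φ y} := by
    refine fun y hy ↦ ContinuousAt.continuousWithinAt ?_
    have hy0 : φ y ≠ 0 := (hφpos y hy).ne'
    have hl : ContinuousAt (fun z ↦ Real.log (φ z)) y :=
      (Real.continuousAt_log hy0).comp' hφc.continuousAt
    exact (hRc.continuousAt.sub (continuousAt_const.mul hl)).add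
      (continuousAt_const.mul hφc.continuousAt)
  -- `V → ∞` as `φ → ∞`: beyond `φ = T` the values exceed `V x`
  set B : ℝ := c + c * Real.log (ε / (2 * c)) with hBdef
  set T : ℝ := max (φ x) (2 * (V x - B) / ε) with hTdef
  have hfar : ∀ y, ρ ≤ φ y → T < φ y → V x ≤ V y := by
    intro y hy hTy
    have h1 := mul_log_le_linear hc hε (hφpos y hy)
    have h2 : 2 * (V x - B) / ε < φ y := lt_of_le_of_lt (le_max_right _ _) hTy
    rw [div_lt_iff₀ hε] at h2
    have h3 : V y = h.scalarCurvature y - c * Real.log (φ y) + ε * φ y := rfl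
    rw [h3]
    linarith [hR0 y]
  -- the compact set `K = {ρ ≤ φ ≤ T}` and a minimiser `p` of `V` on it
  set K : Set N := {y | ρ ≤ φ y ∧ φ y ≤ T} with hKdef
  have hKc : IsCompact K :=
    (hK T).of_isClosed_subset
      ((isClosed_le continuous_const hφc).inter (isClosed_le hφc continuous_const)) fun y hy ↦ hy.2
  have hxK : x ∈ K := ⟨hx, le_max_left _ _⟩
  obtain ⟨p, hpK, hpmin⟩ := hKc.exists_isMinOn ⟨x, hxK⟩ (hVc.mono fun y hy ↦ hy.1)
  have hpA : ρ ≤ φ p := hpK.1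
  have hp0 : 0 < φ p := hφpos p hpA
  -- `p` minimises `V` on all of `A`
  have hmin : ∀ y, ρ ≤ φ y → V p ≤ V y := by
    intro y hy
    by_cases hyT : φ y ≤ T
    · exact hpmin ⟨hy, hyT⟩
    · exact (hpmin hxK).trans (hfar y hy (not_le.1 hyT))
  -- the lower bound at `p`
  have hVp : -(c * Real.log ρ) ≤ V p := by
    have h3 : V p = h.scalarCurvature p - c * Real.log (φ p) + ε * φ p := rfl
    rcases hpA.lt_or_eq with hlt | heq
    · -- interior minimum: `dV_p = 0`
      have hloc : IsLocalMin V p :=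
        Filter.mem_of_superset ((isOpen_lt continuous_const hφc).mem_nhds hlt)
          fun y hy ↦ hmin y (le_of_lt hy)
      have hcrit : mfderiv (𝓡 3) 𝓘(ℝ, ℝ) V p = 0 :=
        Literature.Topology.FourManifolds.IsLocalMin.isMCriticalPt (I := 𝓡 3) hloc
      have hRd : MDifferentiableAt (𝓡 3) 𝓘(ℝ, ℝ) h.scalarCurvature p :=
        (contMDiff_scalarCurvature h).mdifferentiableAt (by simp)
      have hφd : MDifferentiableAt (𝓡 3) 𝓘(ℝ, ℝ) φ p := hφ.mdifferentiableAt (by simp)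
      have hlogd : HasMFDerivAt (𝓡 3) 𝓘(ℝ, ℝ) (Real.log ∘ φ) p
          (((1 : ℝ →L[ℝ] ℝ).smulRight (φ p)⁻¹).comp (mfderiv (𝓡 3) 𝓘(ℝ, ℝ) φ p)) :=
        (Real.hasDerivAt_log hp0.ne').hasFDerivAt.hasMFDerivAt.comp p hφd.hasMFDerivAt
      have hVeq : V = h.scalarCurvature - c • (Real.log ∘ φ) + ε • φ := by
        funext y
        simp [hVdef, smul_eq_mul]
      have hVd := (hRd.hasMFDerivAt.sub (hlogd.const_smul c)).add (hφd.hasMFDerivAt.const_smul ε)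
      rw [← hVeq] at hVd
      have hzero := hVd.mfderiv.symm.trans hcrit
      -- evaluate on `Y = ∇φ(p)`
      set Y : TangentSpace (𝓡 3) p :=
        h.sharp p (mvfderiv (𝓡 3) φ p : TangentSpace (𝓡 3) p →ₗ[ℝ] ℝ) with hYdef
      have hkey : mvfderiv (𝓡 3) h.scalarCurvature p Y
          - c * (mvfderiv (𝓡 3) φ p Y * (φ p)⁻¹) + ε * mvfderiv (𝓡 3) φ p Y = 0 :=
        DFunLike.congr_fun hzero Y
      have hdφY : mvfderiv (𝓡 3) φ p Y = h.gradSq φ p := (h.gradSq_eq φ p).symm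
      have hvalY : h.val p Y Y = h.gradSq φ p := by
        rw [hYdef, val_sharp_apply]
        rfl
      have hdRY : mvfderiv (𝓡 3) h.scalarCurvature p Y = 2 * h.ricci p Y Y :=
        mvfderiv_scalarCurvature_of_soliton h hφ hsol p Y
      have hRicY : c / φ p * h.gradSq φ p ≤ h.ricci p Y Y := hvalY ▸ hRic p Y hpA
      have hG0 : 0 ≤ h.gradSq φ p := h.gradSq_nonneg hh φ p
      rw [hdRY, hdφY] at hkey
      have e : c * (h.gradSq φ p * (φ p)⁻¹) = c / φ p * h.gradSq φ p := by ring
      have hpos : 0 ≤ c / φ p * h.gradSq φ p := mul_nonneg (div_nonneg hc.le hp0.le) hG0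
      have hεG : ε * h.gradSq φ p ≤ ε * 0 := by rw [mul_zero]; linarith
      have hG : h.gradSq φ p = 0 := le_antisymm (le_of_mul_le_mul_left hεG hε) hG0
      rw [h3]
      have h4 := hend p hpA hG
      nlinarith [mul_pos hε hp0]
    · -- boundary point: `φ p = ρ`
      rw [h3, ← heq]
      nlinarith [hR0 p, mul_pos hε hρ0]
  exact hVp.trans (hmin x hx)

end ThreeShrinker

end Literature.Geometry.Riemannian

end
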